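import Summits.CriticalPhenomena.PercolationContinuityZ3.Theorems.Transplant.SkelPhiCorridorKGBoxes
import HarnessLib

/-!
# N2 (frames-only node `SamePDropOfSkeletonFrm₁`, OPEN), (C) column, (R-45) located item (stmt-g21 2026-08-23T15:29:00Z): **THE x-CORRIDOR'S PRISM IN
# AN ASYMMETRIC FRAME BOX WITH THE TIGHT ROWS TOP** — `Skelφ.kgZ₁top`, `Skelφ.mem_kgCorrSched_prism_box₂`

`mem_kgCorrSched_prism_box` (SkelPhiCorridorKGBoxes) puts the prism of `kgCorrSched` in the SYMMETRIC rows window `[−Z₁, Z₁]` with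
`Z₁ = A₁ + P + Wm₂ + Wp₂ + (m₁+m₂+2)(R′+ρ) + R′ + L`; the terms `P + Wm₂ + Wp₂ + (R′+ρ)` are needed only BELOW (the along-parking boxes hang under
`A⁺`).  With the asymmetric habitat room of (R-45) (`−hB ≤ · ≤ hF`, forward room `hF` sized to the corridor's true forward reach) the FORWARD (upper) rows
edge must be tight: from the three cases of `mem_kgCorrSched_prism_cases` the prism's rows satisfy `y 1 ≤ Z₁top := A₁ + (m₁+m₂+1)(R′+ρ) + R′ + L`
(run: `A₁ + L`; across-parking: `A₁ + m₁(R′+ρ) + R′ + L`; along-parking: `A₁ + (m₁+1)(R′+ρ) + m₂(R′+ρ) + R′ + L`), i.e. `Z₁ − Z₁top = P + Wm₂ + Wp₂ +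
(R′+ρ)` (≈ 4σ at the values of record).  `mem_kgCorrSched_prism_box₂` = the box `[−Z₀, (N+1)n + Z₀] × [−Z₁, Z₁top]`; the (C) V rooms files read their
prism rows `hPl/hPt` over it.  Cell-free.
builds on p205010 (kernel theorem, internal audit signed; external expert review pending) — nothing in this file uses p205010; nothing here is a claim
about the open node `SamePDropOfSkeletonFrm₁`.
Lane `prim-bschramm`, seat `prim-bschramm-p5` (gen 16); helper file (`--supports stmt-CriticalPhenomena-4575 --as helper`).
[cite: KozmaNitzan2024, §4 Lemma 12 (pp. 23–25)] [cite: MartineauTassion2017, §3.2]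
-/

noncomputable section

namespace Summit.CriticalPhenomena.PercolationContinuityZ3.Theorems

namespace Transplant

namespace Skelφ

open Literature.Probability.Percolation Literature.Probability.LatticeModels SimpleGraph
open ChainPlanar ChainPara

section BoxX2

variable {n ℓ : ℕ} {hs v : ℤ} {R' ρ q W N m₁ Wm₂ Wp₂ m₂ : ℕ}
  (hP₁ : ParkOK (kgPark₁ n ℓ hs v R' ρ q W N m₁)) (hP₂ : ParkOK (kgPark₂ n ℓ hs v R' ρ q W N m₁ Wm₂ Wp₂ m₂))
  (hsplit : (Wm₂ : ℤ) + Wp₂ = (kgPark₁ n ℓ hs v R' ρ q W N m₁).aHi (m₁ + 1) - ParkPrm.aLo (kgPark₁ n ℓ hs v R' ρ q W N m₁) (m₁ + 1))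

/-- **Tight rows TOP of the prism box**: `Z₁top := A₁ + (m₁+m₂+1)(R′+ρ) + R′ + L` (`A₁ = kgA₁`, `L = ⌊3nℓ/U⌋+1`). [this work] -/
def kgZ₁top (n ℓ : ℕ) (hs : ℤ) (R' ρ W N m₁ m₂ : ℕ) : ℤ :=
  ((kgA₁ n ℓ hs R' W N : ℕ) : ℤ) + ((m₁ : ℤ) + m₂ + 1) * (R' + ρ) + R' + ((3 * (n * ℓ) / shearUnit n hs + 1 : ℕ) : ℤ)

omit hP₁ hP₂ hsplit in
/-- `Z₁top ≤ Z₁` (the tight top lies inside the symmetric window). [this work] -/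
theorem kgZ₁top_le_kgZ₁ : kgZ₁top n ℓ hs R' ρ W N m₁ m₂ ≤ kgZ₁ n ℓ hs R' ρ W N m₁ Wm₂ Wp₂ m₂ := by
  unfold kgZ₁top kgZ₁
  have hρ0 : (0 : ℤ) ≤ ρ := by positivity
  have hR0 : (0 : ℤ) ≤ R' := by positivity
  have hWm : (0 : ℤ) ≤ Wm₂ := by positivity
  have hWp : (0 : ℤ) ≤ Wp₂ := by positivity
  have hP0 : (0 : ℤ) ≤ ((n * ℓ / shearUnit n hs + 1 : ℕ) : ℤ) := by positivity
  nlinarith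

include hP₁ hP₂ hsplit in
/-- **THE PRISM OF THE K-G CORRIDOR LIES IN THE ASYMMETRIC FRAME BOX** `[−Z₀, (N+1)n + Z₀] × [−Z₁, Z₁top]` (any admissible slots): the lower three
edges are `mem_kgCorrSched_prism_box`'s, the rows top is the maximum of the three phase tops of `mem_kgCorrSched_prism_cases`. [this work] -/
theorem mem_kgCorrSched_prism_box₂ {y : Site 2} (hy : y ∈ (kgCorrSched hP₁ hP₂ hsplit).prism) :
    -kgZ₀ n v R' ρ q N m₁ m₂ ≤ y 0 ∧ y 0 ≤ ((N : ℤ) + 1) * n + kgZ₀ n v R' ρ q N m₁ m₂ ∧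
      -kgZ₁ n ℓ hs R' ρ W N m₁ Wm₂ Wp₂ m₂ ≤ y 1 ∧ y 1 ≤ kgZ₁top n ℓ hs R' ρ W N m₁ m₂ := by
  obtain ⟨h1, h2, h3, -⟩ := mem_kgCorrSched_prism_box hP₁ hP₂ hsplit hy
  refine ⟨h1, h2, h3, ?_⟩
  have hρ0 : (0 : ℤ) ≤ ρ := by positivity
  have hR0 : (0 : ℤ) ≤ R' := by positivity
  have p1 : (0 : ℤ) ≤ (m₁ : ℤ) * (R' + ρ) := by positivity
  have p2 : (0 : ℤ) ≤ (m₂ : ℤ) * (R' + ρ) := by positivity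
  have hA₁ : ((kgA₁ n ℓ hs R' W N : ℕ) : ℤ) = (n : ℤ) * ℓ / (shearUnit n hs : ℕ) + 1 + W + ((N : ℤ) + 1) * R' := by
    unfold kgA₁; push_cast; ring
  have e : ((m₁ : ℤ) + m₂ + 1) * (R' + ρ) = (m₁ : ℤ) * (R' + ρ) + (m₂ : ℤ) * (R' + ρ) + (R' + ρ) := by ring
  unfold kgZ₁top
  rw [e]
  push_cast
  rw [hA₁]
  rcases mem_kgCorrSched_prism_cases hP₁ hP₂ hsplit hy with ⟨-, -, h⟩ | ⟨-, h, -⟩ | ⟨-, -, -, h⟩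
  · obtain ⟨-, hb⟩ := abs_le.1 h
    push_cast at hb
    linarith
  · push_cast at h
    rw [hA₁] at h
    linarith
  · have e1 : ((m₁ : ℤ) + 1) * (R' + ρ) = (m₁ : ℤ) * (R' + ρ) + (R' + ρ) := by ring
    push_cast at h
    rw [hA₁, e1] at h
    linarith

end BoxX2

end Skelφ

end Transplant

end Summit.CriticalPhenomena.PercolationContinuityZ3.Theorems

end
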